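import Mathlib
import Literature.Analysis.FluidPDE.StretchedLayerNS
import Summits.AnomalousDissipation.AnomalousDissipation.Theorems.MarginalStabilityChainStretchedVortexRowsStubPressureReconstructionTools
import HarnessLib

/-!
# Stub `stub_pressureReconstruction` of the line `braid-closed-large-circulation-gluing`
# (crux stmt-AnomalousDissipation-3009, `MarginalStabilityChain.StretchedVortexRows`)

**Pressure reconstruction.** The line constructs a steady co-rotating stretched-vortex row of the
stretched two-dimensional Navier–Stokes class (`γ = ΔU = 1`) in VORTICITY form: a velocity pair
`(u, v) ∈ C³`, `L`-periodic in `x`, divergence free, with the shear far field `u → ±1/2`, `v → 0`,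
an exponential decay package for `∇(u, v)` and `∂_y∂_y u`, and the steady vorticity equation
`u ωₓ + (v − y) ω_y = ω + νΔω` for `ω = ∂ₓv − ∂_yu`. This file turns that output into a member of
the typed class `Literature.Analysis.FluidPDE.IsSteadyStretchedLayerNSSolution ν 1 1 L u v p` by
reconstructing the pressure:

1. the momentum residual `F₁ = -(u uₓ + (v − y) u_y) + νΔu`, `F₂ = -(u vₓ + (v − y) v_y − v) + νΔv`
   is jointly `C¹` (`contDiff_residual_x/y`) and CURL-FREE: `∂_y F₁ = ∂ₓ F₂` is exactly the
   vorticity equation — the cross terms collect into `(uₓ + v_y) ω = 0` after commuting the mixed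
   partials of the `C³` fields (`residual_curl_free`, a `linear_combination` of the vorticity
   equation, the divergence constraint and four Schwarz identities);
2. hence `F = (∂ₓ p, ∂_y p)` for a jointly `C¹` potential `p` (plane Poincaré lemma in slice form,
   `PressureTools.exists_potential` of the Tools module), which gives `momentum_x/y` and `contDiff_p`;
3. `p (x + L, y) − p (x, y)` is the constant `∫₀ᴸ F₁ (s, y₀) ds` (`potential_shift_eq_integral`);
   by periodicity of `u` the exact terms `-(u uₓ) + ν uₓₓ` integrate to zero and the remainder
   `-(v − y) u_y + ν u_yy` is `O((1 + y) e^{-a y})` uniformly on a period (`v` grows at most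
   linearly from its bounded trace on `[0, L] × {0}` since `|∂_y v| ≤ C'`), so the constant tends to
   `0` as `y₀ → +∞` (`tendsto_period_integral_residual_x`) and vanishes: `p` is `L`-periodic.

The remaining fields of the structure are hypotheses (`C³ ⇒ C²`, divergence, periodicity, far field).
-/

set_option linter.dupNamespace false

noncomputable section

open scoped Topology ContDiff
open Filter Set Function MeasureTheory intervalIntegral

namespace Summit.AnomalousDissipation.AnomalousDissipation.Theorems.MarginalStabilityChainStretchedVortexRows

open Literature.Analysis.FluidPDE Literature.Analysis.FluidPDE.StretchedLayer

namespace PressureTools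

/-! ### The momentum residual of a steady stretched-layer velocity field (`γ = 1`) -/

section Residual

variable {ν L : ℝ} {u v : ℝ → ℝ → ℝ}

/-- The `x`-momentum residual `F₁ = -(u uₓ + (v - y) u_y) + νΔu` is jointly `C¹` for `C³`
velocities. [folklore] -/
theorem contDiff_residual_x (hu : ContDiff ℝ 3 (fun q : ℝ × ℝ => u q.1 q.2))
    (hv : ContDiff ℝ 3 (fun q : ℝ × ℝ => v q.1 q.2)) :
    ContDiff ℝ 1 (fun q : ℝ × ℝ =>
      -(u q.1 q.2 * dX u q.1 q.2 + (v q.1 q.2 - q.2) * dY u q.1 q.2) + ν * lap u q.1 q.2) := by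
  have h13 : (1 : WithTop ℕ∞) + 1 ≤ 3 := by norm_num
  have h23 : (2 : WithTop ℕ∞) + 1 ≤ 3 := by norm_num
  have h12 : (1 : WithTop ℕ∞) + 1 ≤ 2 := by norm_num
  have hu1 : ContDiff ℝ 1 (fun q : ℝ × ℝ => u q.1 q.2) := hu.of_le (by norm_num)
  have hv1 : ContDiff ℝ 1 (fun q : ℝ × ℝ => v q.1 q.2) := hv.of_le (by norm_num)
  have hXu := contDiff_dX_of_le hu h13
  have hYu := contDiff_dY_of_le hu h13
  have hXXu := contDiff_dX_of_le (contDiff_dX_of_le hu h23) h12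
  have hYYu := contDiff_dY_of_le (contDiff_dY_of_le hu h23) h12
  simp only [lap_apply]
  exact ((hu1.mul hXu).add ((hv1.sub contDiff_snd).mul hYu)).neg.add
    (contDiff_const.mul (hXXu.add hYYu))

/-- The `y`-momentum residual `F₂ = -(u vₓ + (v - y) v_y - v) + νΔv` is jointly `C¹` for `C³`
velocities. [folklore] -/
theorem contDiff_residual_y (hu : ContDiff ℝ 3 (fun q : ℝ × ℝ => u q.1 q.2))
    (hv : ContDiff ℝ 3 (fun q : ℝ × ℝ => v q.1 q.2)) :
    ContDiff ℝ 1 (fun q : ℝ × ℝ =>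
      -(u q.1 q.2 * dX v q.1 q.2 + (v q.1 q.2 - q.2) * dY v q.1 q.2 - v q.1 q.2) + ν * lap v q.1 q.2) := by
  have h13 : (1 : WithTop ℕ∞) + 1 ≤ 3 := by norm_num
  have h23 : (2 : WithTop ℕ∞) + 1 ≤ 3 := by norm_num
  have h12 : (1 : WithTop ℕ∞) + 1 ≤ 2 := by norm_num
  have hu1 : ContDiff ℝ 1 (fun q : ℝ × ℝ => u q.1 q.2) := hu.of_le (by norm_num)
  have hv1 : ContDiff ℝ 1 (fun q : ℝ × ℝ => v q.1 q.2) := hv.of_le (by norm_num)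
  have hXv := contDiff_dX_of_le hv h13
  have hYv := contDiff_dY_of_le hv h13
  have hXXv := contDiff_dX_of_le (contDiff_dX_of_le hv h23) h12
  have hYYv := contDiff_dY_of_le (contDiff_dY_of_le hv h23) h12
  simp only [lap_apply]
  exact (((hu1.mul hXv).add ((hv1.sub contDiff_snd).mul hYv)).sub hv1).neg.add
    (contDiff_const.mul (hXXv.add hYYv))

/-- `F₁` inherits `x`-periodicity from `(u, v)`. [folklore] -/
theorem residual_x_periodic (hu : ∀ x y, u (x + L) y = u x y) (hv : ∀ x y, v (x + L) y = v x y)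
    (x y : ℝ) :
    -(u (x + L) y * dX u (x + L) y + (v (x + L) y - y) * dY u (x + L) y) + ν * lap u (x + L) y =
      -(u x y * dX u x y + (v x y - y) * dY u x y) + ν * lap u x y := by
  rw [lap_apply, lap_apply, hu, hv, dX_periodic hu, dY_periodic hu, dX_periodic (dX_periodic hu),
    dY_periodic (dY_periodic hu)]

/-- `F₂` inherits `x`-periodicity from `(u, v)`. [folklore] -/
theorem residual_y_periodic (hu : ∀ x y, u (x + L) y = u x y) (hv : ∀ x y, v (x + L) y = v x y)
    (x y : ℝ) :
    -(u (x + L) y * dX v (x + L) y + (v (x + L) y - y) * dY v (x + L) y - v (x + L) y) +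
        ν * lap v (x + L) y =
      -(u x y * dX v x y + (v x y - y) * dY v x y - v x y) + ν * lap v x y := by
  rw [lap_apply, lap_apply, hu, hv, dX_periodic hv, dY_periodic hv, dX_periodic (dX_periodic hv),
    dY_periodic (dY_periodic hv)]

/-- **The momentum residual is curl-free**: `∂_y F₁ = ∂ₓ F₂` is exactly the steady vorticity
equation `u ωₓ + (v - y) ω_y = ω + νΔω`, `ω = vₓ - u_y`, given `uₓ + v_y = 0` (expand, commute the
mixed partials of the `C³` fields, and collect `(uₓ + v_y) ω = 0`). [folklore] -/
theorem residual_curl_free (hu : ContDiff ℝ 3 (fun q : ℝ × ℝ => u q.1 q.2))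
    (hv : ContDiff ℝ 3 (fun q : ℝ × ℝ => v q.1 q.2))
    (hdiv : ∀ x y, dX u x y + dY v x y = 0)
    (hvort : ∀ x y, u x y * dX (fun a b => dX v a b - dY u a b) x y +
        (v x y - y) * dY (fun a b => dX v a b - dY u a b) x y =
      (dX v x y - dY u x y) + ν * lap (fun a b => dX v a b - dY u a b) x y) (x y : ℝ) :
    dY (fun a b => -(u a b * dX u a b + (v a b - b) * dY u a b) + ν * lap u a b) x y =
      dX (fun a b => -(u a b * dX v a b + (v a b - b) * dY v a b - v a b) + ν * lap v a b) x y := by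
  -- regularity bookkeeping
  have h23 : (2 : WithTop ℕ∞) + 1 ≤ 3 := by norm_num
  have h12 : (1 : WithTop ℕ∞) + 1 ≤ 2 := by norm_num
  have hu2 : ContDiff ℝ 2 (fun q : ℝ × ℝ => u q.1 q.2) := hu.of_le (by norm_num)
  have hv2 : ContDiff ℝ 2 (fun q : ℝ × ℝ => v q.1 q.2) := hv.of_le (by norm_num)
  have hXu := contDiff_dX_of_le hu h23
  have hYu := contDiff_dY_of_le hu h23
  have hXv := contDiff_dX_of_le hv h23
  have hYv := contDiff_dY_of_le hv h23
  have hXXu := contDiff_dX_of_le hXu h12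
  have hXYu := contDiff_dX_of_le hYu h12
  have hYYu := contDiff_dY_of_le hYu h12
  have hXXv := contDiff_dX_of_le hXv h12
  have hYXv := contDiff_dY_of_le hXv h12
  have hYYv := contDiff_dY_of_le hYv h12
  have D : ∀ {g : ℝ → ℝ → ℝ} {n : WithTop ℕ∞}, ContDiff ℝ n (fun q : ℝ × ℝ => g q.1 q.2) → n ≠ 0 →
      ∀ q, DifferentiableAt ℝ (fun q : ℝ × ℝ => g q.1 q.2) q :=
    fun hg hn q => (hg.differentiable hn) q
  -- the vorticity equation, expanded
  have eXfun : dX (fun a b => dX v a b - dY u a b) = fun a b => dX (dX v) a b - dX (dY u) a b := by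
    funext a b; exact dX_fun_sub (D hXv two_ne_zero _) (D hYu two_ne_zero _)
  have eYfun : dY (fun a b => dX v a b - dY u a b) = fun a b => dY (dX v) a b - dY (dY u) a b := by
    funext a b; exact dY_fun_sub (D hXv two_ne_zero _) (D hYu two_ne_zero _)
  have e3X : dX (fun a b => dX (dX v) a b - dX (dY u) a b) x y =
      dX (dX (dX v)) x y - dX (dX (dY u)) x y :=
    dX_fun_sub (D hXXv one_ne_zero _) (D hXYu one_ne_zero _)
  have e3Y : dY (fun a b => dY (dX v) a b - dY (dY u) a b) x y =
      dY (dY (dX v)) x y - dY (dY (dY u)) x y :=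
    dY_fun_sub (D hYXv one_ne_zero _) (D hYYu one_ne_zero _)
  have hV := hvort x y
  simp only [lap_apply, eXfun, eYfun, e3X, e3Y] at hV
  -- `∂_y F₁`
  have h3 : (3 : WithTop ℕ∞) ≠ 0 := by norm_num
  have aU : HasDerivAt (fun s => u x s) (dY u x y) y := hasDerivAt_dY (D hu h3 _)
  have aXu : HasDerivAt (fun s => dX u x s) (dY (dX u) x y) y := hasDerivAt_dY (D hXu two_ne_zero _)
  have aV : HasDerivAt (fun s => v x s) (dY v x y) y := hasDerivAt_dY (D hv h3 _)
  have aYu : HasDerivAt (fun s => dY u x s) (dY (dY u) x y) y := hasDerivAt_dY (D hYu two_ne_zero _)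
  have aXXu : HasDerivAt (fun s => dX (dX u) x s) (dY (dX (dX u)) x y) y :=
    hasDerivAt_dY (D hXXu one_ne_zero _)
  have aYYu : HasDerivAt (fun s => dY (dY u) x s) (dY (dY (dY u)) x y) y :=
    hasDerivAt_dY (D hYYu one_ne_zero _)
  have hF₁ : HasDerivAt (fun s => -(u x s * dX u x s + (v x s - s) * dY u x s) + ν * lap u x s)
      (-(dY u x y * dX u x y + u x y * dY (dX u) x y +
          ((dY v x y - 1) * dY u x y + (v x y - y) * dY (dY u) x y)) +
        ν * (dY (dX (dX u)) x y + dY (dY (dY u)) x y)) y :=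
    ((aU.fun_mul aXu).fun_add ((aV.fun_sub (hasDerivAt_id' y)).fun_mul aYu)).fun_neg.fun_add
      ((aXXu.fun_add aYYu).const_mul ν)
  -- `∂ₓ F₂`
  have bU : HasDerivAt (fun s => u s y) (dX u x y) x := hasDerivAt_dX (D hu h3 _)
  have bXv : HasDerivAt (fun s => dX v s y) (dX (dX v) x y) x := hasDerivAt_dX (D hXv two_ne_zero _)
  have bV : HasDerivAt (fun s => v s y) (dX v x y) x := hasDerivAt_dX (D hv h3 _)
  have bYv : HasDerivAt (fun s => dY v s y) (dX (dY v) x y) x := hasDerivAt_dX (D hYv two_ne_zero _)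
  have bXXv : HasDerivAt (fun s => dX (dX v) s y) (dX (dX (dX v)) x y) x :=
    hasDerivAt_dX (D hXXv one_ne_zero _)
  have bYYv : HasDerivAt (fun s => dY (dY v) s y) (dX (dY (dY v)) x y) x :=
    hasDerivAt_dX (D hYYv one_ne_zero _)
  have hF₂ : HasDerivAt
      (fun s => -(u s y * dX v s y + (v s y - y) * dY v s y - v s y) + ν * lap v s y)
      (-(dX u x y * dX v x y + u x y * dX (dX v) x y +
          (dX v x y * dY v x y + (v x y - y) * dX (dY v) x y) - dX v x y) +
        ν * (dX (dX (dX v)) x y + dX (dY (dY v)) x y)) x :=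
    (((bU.fun_mul bXv).fun_add ((bV.sub_const y).fun_mul bYv)).fun_sub bV).fun_neg.fun_add
      ((bXXv.fun_add bYYv).const_mul ν)
  have e₁ : dY (fun a b => -(u a b * dX u a b + (v a b - b) * dY u a b) + ν * lap u a b) x y =
      -(dY u x y * dX u x y + u x y * dY (dX u) x y +
          ((dY v x y - 1) * dY u x y + (v x y - y) * dY (dY u) x y)) +
        ν * (dY (dX (dX u)) x y + dY (dY (dY u)) x y) := hF₁.deriv
  have e₂ : dX (fun a b => -(u a b * dX v a b + (v a b - b) * dY v a b - v a b) + ν * lap v a b) x y =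
      -(dX u x y * dX v x y + u x y * dX (dX v) x y +
          (dX v x y * dY v x y + (v x y - y) * dX (dY v) x y) - dX v x y) +
        ν * (dX (dX (dX v)) x y + dX (dY (dY v)) x y) := hF₂.deriv
  -- mixed partials
  have m_u : dX (dY u) x y = dY (dX u) x y := dX_dY_comm hu2 x y
  have m_v : dX (dY v) x y = dY (dX v) x y := dX_dY_comm hv2 x y
  have t_u : dX (dX (dY u)) x y = dY (dX (dX u)) x y := by
    have hfun : dX (dY u) = dY (dX u) := funext fun a => funext fun b => dX_dY_comm hu2 a b
    rw [hfun]; exact dX_dY_comm hXu x y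
  have t_v : dY (dY (dX v)) x y = dX (dY (dY v)) x y := by
    have hfun : dY (dX v) = dX (dY v) := funext fun a => funext fun b => (dX_dY_comm hv2 a b).symm
    rw [hfun]; exact (dX_dY_comm hYv x y).symm
  rw [e₁, e₂]
  have hd := hdiv x y
  linear_combination hV + (dX v x y - dY u x y) * hd + u x y * m_u + (v x y - y) * m_v - ν * t_u +
    ν * t_v

/-- **The period integral of `F₁` tends to `0` across the layer.** With `u` periodic the exact
terms drop out (`integral_exact_terms_eq_zero`), and the rest `-(v - y) u_y + ν u_yy` is
`O((1 + |y|) e^{-a|y|})` uniformly on a period, because `v` grows at most linearly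
(`|∂_y v| ≤ C'`) from its bounded trace on `[0, L] × {0}`. [folklore] -/
theorem tendsto_period_integral_residual_x {C' a : ℝ} (hL : 0 < L) (ha : 0 < a)
    (hu : ContDiff ℝ 3 (fun q : ℝ × ℝ => u q.1 q.2)) (hv : ContDiff ℝ 3 (fun q : ℝ × ℝ => v q.1 q.2))
    (hper : ∀ x y, u (x + L) y = u x y)
    (hdec : ∀ x y, |dX u x y| + |dY u x y| + |dX v x y| + |dY v x y| + |dY (dY u) x y| ≤
      C' * Real.exp (-a * |y|)) :
    Tendsto (fun y => ∫ s in (0 : ℝ)..L,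
      (-(u s y * dX u s y + (v s y - y) * dY u s y) + ν * lap u s y)) atTop (𝓝 0) := by
  have h23 : (2 : WithTop ℕ∞) + 1 ≤ 3 := by norm_num
  have h12 : (1 : WithTop ℕ∞) + 1 ≤ 2 := by norm_num
  have hu2 : ContDiff ℝ 2 (fun q : ℝ × ℝ => u q.1 q.2) := hu.of_le (by norm_num)
  have hXu := contDiff_dX_of_le hu h23
  have hYu := contDiff_dY_of_le hu h23
  have hXXu := contDiff_dX_of_le hXu h12
  have hYYu := contDiff_dY_of_le hYu h12
  have hvd : Differentiable ℝ (fun q : ℝ × ℝ => v q.1 q.2) := hv.differentiable (by norm_num)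
  -- pointwise consequences of the decay package
  have hC' : 0 ≤ C' := (le_of_le_mul_exp ha (by positivity) (hdec 0 0)).2
  have hsum : ∀ x y, |dY u x y| ≤ C' * Real.exp (-a * |y|) ∧
      |dY (dY u) x y| ≤ C' * Real.exp (-a * |y|) ∧ |dY v x y| ≤ C' * Real.exp (-a * |y|) := by
    intro x y
    have h := hdec x y
    have h1 := abs_nonneg (dX u x y)
    have h2 := abs_nonneg (dY u x y)
    have h3 := abs_nonneg (dX v x y)
    have h4 := abs_nonneg (dY v x y)
    have h5 := abs_nonneg (dY (dY u) x y)
    exact ⟨by linarith, by linarith, by linarith⟩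
  have bYu : ∀ x y, |dY u x y| ≤ C' * Real.exp (-a * |y|) := fun x y => (hsum x y).1
  have bYYu : ∀ x y, |dY (dY u) x y| ≤ C' * Real.exp (-a * |y|) := fun x y => (hsum x y).2.1
  have bYv : ∀ x y, |dY v x y| ≤ C' := fun x y =>
    (le_of_le_mul_exp ha (abs_nonneg _) (hsum x y).2.2).1
  -- `v` is bounded on the trace `[0, L] × {0}` and grows at most linearly in `y`
  obtain ⟨M, hM⟩ := (isCompact_Icc (a := (0 : ℝ)) (b := L)).exists_bound_of_continuousOn
    ((continuous_sliceX hv.continuous 0).continuousOn)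
  have hvb : ∀ s ∈ Set.Icc (0 : ℝ) L, ∀ y, |v s y| ≤ M + C' * |y| := by
    intro s hs y
    have h1 := abs_sub_le_of_dY_bound hvd bYv s y
    have h2 : |v s 0| ≤ M := by simpa [Real.norm_eq_abs] using hM s hs
    calc |v s y| = |(v s y - v s 0) + v s 0| := by ring_nf
      _ ≤ |v s y - v s 0| + |v s 0| := abs_add_le _ _
      _ ≤ M + C' * |y| := by linarith
  -- drop the exact terms
  have hsplit : ∀ y, ∫ s in (0 : ℝ)..L, (-(u s y * dX u s y + (v s y - y) * dY u s y) + ν * lap u s y) =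
      ∫ s in (0 : ℝ)..L, (-((v s y - y) * dY u s y) + ν * dY (dY u) s y) := by
    intro y
    have c1 := continuous_sliceX hu.continuous y
    have c2 := continuous_sliceX hXu.continuous y
    have c3 := continuous_sliceX hXXu.continuous y
    have c4 := continuous_sliceX hv.continuous y
    have c5 := continuous_sliceX hYu.continuous y
    have c6 := continuous_sliceX hYYu.continuous y
    have hi1 : IntervalIntegrable (fun s => -(u s y * dX u s y) + ν * dX (dX u) s y) volume 0 L := by
      apply Continuous.intervalIntegrable; fun_prop
    have hi2 : IntervalIntegrable (fun s => -((v s y - y) * dY u s y) + ν * dY (dY u) s y)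
        volume 0 L := by
      apply Continuous.intervalIntegrable; fun_prop
    have hfun : (fun s => -(u s y * dX u s y + (v s y - y) * dY u s y) + ν * lap u s y) =
        fun s => (-(u s y * dX u s y) + ν * dX (dX u) s y) +
          (-((v s y - y) * dY u s y) + ν * dY (dY u) s y) := by
      funext s; rw [lap_apply]; ring
    rw [hfun, integral_add hi1 hi2, integral_exact_terms_eq_zero hu2 hper y, zero_add]
  -- the bound on the remainder, for `y ≥ 0`
  have hbound : ∀ y, 0 ≤ y → ‖∫ s in (0 : ℝ)..L,
      (-(u s y * dX u s y + (v s y - y) * dY u s y) + ν * lap u s y)‖ ≤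
      ((M + |ν|) * C' + ((C' + 1) * C') * y) * Real.exp (-a * y) * L := by
    intro y hy
    rw [hsplit y]
    have hay : |y| = y := abs_of_nonneg hy
    have h := norm_integral_le_of_norm_le_const (a := (0 : ℝ)) (b := L)
      (f := fun s => -((v s y - y) * dY u s y) + ν * dY (dY u) s y)
      (C := ((M + |ν|) * C' + ((C' + 1) * C') * y) * Real.exp (-a * y)) ?_
    · simpa [abs_of_pos hL] using h
    intro s hs
    rw [uIoc_of_le hL.le] at hs
    have hs' : s ∈ Set.Icc (0 : ℝ) L := Set.Ioc_subset_Icc_self hs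
    have hv' := hvb s hs' y
    rw [hay] at hv'
    have e0 : 0 < Real.exp (-a * y) := Real.exp_pos _
    have h1 := bYu s y
    have h2 := bYYu s y
    rw [hay] at h1 h2
    rw [Real.norm_eq_abs]
    calc |-((v s y - y) * dY u s y) + ν * dY (dY u) s y|
        ≤ |-((v s y - y) * dY u s y)| + |ν * dY (dY u) s y| := abs_add_le _ _
      _ = |v s y - y| * |dY u s y| + |ν| * |dY (dY u) s y| := by rw [abs_neg, abs_mul, abs_mul]
      _ ≤ (M + C' * y + y) * (C' * Real.exp (-a * y)) + |ν| * (C' * Real.exp (-a * y)) := by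
          have hA : |v s y - y| ≤ M + C' * y + y :=
            calc |v s y - y| ≤ |v s y| + |y| := abs_sub _ _
              _ ≤ M + C' * y + y := by rw [hay]; linarith
          have hA0 : 0 ≤ M + C' * y + y := le_trans (abs_nonneg _) hA
          exact add_le_add (mul_le_mul hA h1 (abs_nonneg _) hA0)
            (mul_le_mul_of_nonneg_left h2 (abs_nonneg ν))
      _ = ((M + |ν|) * C' + ((C' + 1) * C') * y) * Real.exp (-a * y) := by ring
  refine squeeze_zero_norm'
    (a := fun y => ((M + |ν|) * C' + ((C' + 1) * C') * y) * Real.exp (-a * y) * L) ?_ ?_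
  · filter_upwards [eventually_ge_atTop (0 : ℝ)] with y hy using hbound y hy
  · simpa using (tendsto_affine_mul_exp_neg ha ((M + |ν|) * C') ((C' + 1) * C')).mul_const L

end Residual

end PressureTools

open PressureTools in
/-- **Pressure reconstruction for steady stretched-layer rows (vorticity form ⇒ typed class,
`γ = ΔU = 1`).** Given `C³`, `L`-periodic, divergence-free `(u, v)` solving the steady vorticity
equation `u ωₓ + (v - y) ω_y = ω + νΔω`, `ω = ∂ₓv - ∂_yu`, with the shear far field and an exponential
decay package for `∇(u, v)` and `∂_y∂_yu`, there is a pressure `p` making `(u, v, p)` a member of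
`IsSteadyStretchedLayerNSSolution ν 1 1 L`. Proof: the momentum residual
`F = (-(u uₓ + (v - y)u_y) + νΔu, -(u vₓ + (v - y)v_y - v) + νΔv)` is `C¹` and curl-free — `∂_yF₁ - ∂ₓF₂`
is exactly the vorticity equation plus `(uₓ + v_y) ω` (`residual_curl_free`) — so `F = ∇p` for a `C¹`
potential (plane Poincaré lemma, `exists_potential`); `p (x + L, y) - p (x, y)` is the constant
`∫₀ᴸ F₁ (s, y₀) ds` (`potential_shift_eq_integral`), which tends to `0` as `y₀ → +∞` by periodicity of
`u` and the decay package (`tendsto_period_integral_residual_x`), hence vanishes: `p` is periodic.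
Statement registered on stmt-AnomalousDissipation-3009 as `stub_pressureReconstruction`. [folklore] -/
theorem stub_pressureReconstruction :
    ∀ (ν L : ℝ) (u v : ℝ → ℝ → ℝ), 0 < L →
      ContDiff ℝ 3 (fun q : ℝ × ℝ => u q.1 q.2) → ContDiff ℝ 3 (fun q : ℝ × ℝ => v q.1 q.2) →
      (∀ x y, u (x + L) y = u x y ∧ v (x + L) y = v x y) →
      (∀ x y, dX u x y + dY v x y = 0) →
      (∀ x y, u x y * dX (fun a b => dX v a b - dY u a b) x y +
          (v x y - y) * dY (fun a b => dX v a b - dY u a b) x y =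
        (dX v x y - dY u x y) + ν * lap (fun a b => dX v a b - dY u a b) x y) →
      (∀ x, Tendsto (fun y => u x y) atTop (𝓝 (1 / 2)) ∧ Tendsto (fun y => u x y) atBot (𝓝 (-(1 / 2))) ∧
        Tendsto (fun y => v x y) atTop (𝓝 0) ∧ Tendsto (fun y => v x y) atBot (𝓝 0)) →
      (∃ C' a : ℝ, 0 < a ∧ ∀ x y,
        |dX u x y| + |dY u x y| + |dX v x y| + |dY v x y| + |dY (dY u) x y| ≤ C' * Real.exp (-a * |y|)) →
      ∃ p : ℝ → ℝ → ℝ, IsSteadyStretchedLayerNSSolution ν 1 1 L u v p := by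
  intro ν L u v hL hu hv hper hdiv hvort hfar hdec
  have hper_u : ∀ x y, u (x + L) y = u x y := fun x y => (hper x y).1
  have hper_v : ∀ x y, v (x + L) y = v x y := fun x y => (hper x y).2
  obtain ⟨C', a, ha, hdec⟩ := hdec
  -- the momentum residual is a `C¹` curl-free field, hence a gradient
  have hF₁ := contDiff_residual_x (ν := ν) hu hv
  have hF₂ := contDiff_residual_y (ν := ν) hu hv
  obtain ⟨p, hp, hpX, hpY⟩ := exists_potential
    (F₁ := fun a b => -(u a b * dX u a b + (v a b - b) * dY u a b) + ν * lap u a b)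
    (F₂ := fun a b => -(u a b * dX v a b + (v a b - b) * dY v a b - v a b) + ν * lap v a b)
    hF₁ hF₂ (residual_curl_free hu hv hdiv hvort)
  have hpX' : ∀ x y, dX p x y = -(u x y * dX u x y + (v x y - y) * dY u x y) + ν * lap u x y := hpX
  have hpY' : ∀ x y, dY p x y = -(u x y * dX v x y + (v x y - y) * dY v x y - v x y) + ν * lap v x y :=
    hpY
  -- periodicity of the pressure: the period shift is a constant that tends to zero
  have hshift : ∀ x y y₀, p (x + L) y - p x y =
      ∫ s in (0 : ℝ)..L, (-(u s y₀ * dX u s y₀ + (v s y₀ - y₀) * dY u s y₀) + ν * lap u s y₀) :=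
    fun x y y₀ => potential_shift_eq_integral
      (F₁ := fun a b => -(u a b * dX u a b + (v a b - b) * dY u a b) + ν * lap u a b)
      (F₂ := fun a b => -(u a b * dX v a b + (v a b - b) * dY v a b - v a b) + ν * lap v a b)
      hp hpX hpY hF₁.continuous (residual_x_periodic hper_u hper_v)
      (residual_y_periodic hper_u hper_v) x y y₀
  have hT := tendsto_period_integral_residual_x (ν := ν) hL ha hu hv hper_u hdec
  have hK : (fun y₀ => ∫ s in (0 : ℝ)..L,
      (-(u s y₀ * dX u s y₀ + (v s y₀ - y₀) * dY u s y₀) + ν * lap u s y₀)) =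
      fun _ => p (0 + L) 0 - p 0 0 := funext fun y₀ => (hshift 0 0 y₀).symm
  rw [hK] at hT
  have hconst : p (0 + L) 0 - p 0 0 = 0 := tendsto_nhds_unique tendsto_const_nhds hT
  have hper_p : ∀ x y, p (x + L) y = p x y := fun x y =>
    sub_eq_zero.1 (by rw [hshift x y 0, ← hshift 0 0 0]; exact hconst)
  exact ⟨p,
    { contDiff_u := hu.of_le (by norm_num)
      contDiff_v := hv.of_le (by norm_num)
      contDiff_p := hp
      momentum_x := fun x y => by rw [hpX' x y]; ring
      momentum_y := fun x y => by rw [hpY' x y]; ring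
      divFree := hdiv
      periodic_u := hper_u
      periodic_v := hper_v
      periodic_p := hper_p
      tendsto_u_atTop := fun x => (hfar x).1
      tendsto_u_atBot := fun x => (hfar x).2.1
      tendsto_v_atTop := fun x => (hfar x).2.2.1
      tendsto_v_atBot := fun x => (hfar x).2.2.2 }⟩

end Summit.AnomalousDissipation.AnomalousDissipation.Theorems.MarginalStabilityChainStretchedVortexRows

end
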